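import Summits.HubbardSuperconductivity.HubbardSuperconductivity.Theorems.LevyLogBootstrapLevyTransportInfraredBound
import Summits.HubbardSuperconductivity.HubbardSuperconductivity.Theorems.LevyLogBootstrapLevyTransportLevyBootstrap
import Summits.HubbardSuperconductivity.HubbardSuperconductivity.Theorems.LevyLogBootstrapLevyTransportStubLevyFloor
import Literature.Probability.LatticeModels.TorusBlockInfraredWing
import HarnessLib

/-!
# Crux `LevyTransport` (stmt-HubbardSuperconductivity-15049, route `LevyLogBootstrap`), input (a)
# in bootstrap form: the `M`-UNIFORM INFRARED WING of the 2×2-block kernel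

The load-bearing stub `stub_logBootstrap` of the line `Cruxes/LevyTransport/Lines/birth.lean` was
reduced (`logBootstrap_explicit_of_inputs`, file `…LogBootstrapInputs`) to four inputs; input (a)
is an `M`-uniform bound `β₀` on the INFRARED WING

  `β(ψ) = (Σ_{q ∈ IR} Σ_X k₂(X) Re χ_q(X)) / (n² k₂(0))`,   `n = M/2`,

of the coarse 2×2-block kernel `k₂(X) = Σ_{x' ∈ block X, y' ∈ block 0} Re⟨ψ, S⁺_{x'} S⁻_{y'} ψ⟩` of a
half-filled sector ground state `ψ` of `H_M(Δ) = xxzHamiltonian 1 (torusGraph 2 M) (-1) Δ`, where the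
infrared box `IR = {q ≠ 0 : ∀ i, cos κ₀ < Re χ_q(eᵢ)}` is the complement in `{q ≠ 0}` of the
ultraviolet set `{q ≠ 0 : ∃ i, Re χ_q(eᵢ) ≤ t}`, `t = cos κ₀`. This file PROVES input (a) with the
explicit constant

  `β(ψ) ≤ 32 κ₀ / π`   for every `0 < κ₀`, every even `M ≥ 4`, every `Δ ∈ [-1, 0]`

(`sectorGS_infraredWing_le`, and the `∀`-closed `infraredWing_le_uniform` in the literal shape of
hypothesis (a) of `logBootstrap_explicit_of_inputs` with `t = cos κ₀`). Ingredients: the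
ground-state Gaussian-domination infrared bound `K̂_ψ(p)² E(p) ≤ 1 - Δ ≤ 2`, `K̂_ψ ≥ 0`
(`sectorGS_transverse_infraredBound`, reflection positivity after Björnberg–Ueltschi), translation
invariance of the kernel (`gs_transverseKernel_eq_sub`), the purely kinematic folding/lattice-sum
estimate `TorusBlock.sum_infrared_blockKernel_mul_re_torusChar_le` (Literature, `b`-general:
`Σ_{IR} Σ_X k_b(X) Re χ_q(X) ≤ (4/π) b⁴ κ₀ M m √(C/8)`), and the diagonal floor `k₂(0) ≥ 4·½ = 2`
(`LevyFloor.transverseKernel_diag`, `LevyFloor.blockKernel_zero_zero_ge`). The constant is not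
optimised (the folding weights all four lifts of a coarse momentum by `1/|q|`, and `k₂(0) ≥ 2`
ignores the twelve positive off-diagonal terms); the numerical verdict on input (d) at `b = 2`
(evidence on the item) is unaffected by such factors.

Sources: T. Kennedy, E. H. Lieb, B. S. Shastry, J. Stat. Phys. 53 (1988) 1019 and Phys. Rev. Lett.
61 (1988) 2582; J. E. Björnberg, D. Ueltschi, arXiv:2204.12896, Lemma 4.4 / Cor. 5.3;
C. Berg, J. P. R. Christensen, P. Ressel (1984) Ch. 4 §3. No definition is introduced; sorry-free.
-/

noncomputable section

set_option linter.dupNamespace false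

namespace Summit.HubbardSuperconductivity.HubbardSuperconductivity.Theorems.LevyLogBootstrap

open scoped BigOperators Matrix ComplexOrder ComplexConjugate
open Matrix Finset Complex
open Literature.MathematicalPhysics.QuantumLattice Literature.Probability.LatticeModels

section Wing

variable (M : ℕ) {m : ℕ} [NeZero M] [NeZero m]

/-- The cosine transform of a kernel written with `torusPhase` is its pairing with the real parts
of the characters: `Σ_z cos(p·z) g(z) = Σ_z g(z) Re χ_p(z)` (`Re χ_p(z) = cos (p·z)`,
`torusChar_re`). [folklore] -/
theorem sum_cos_torusPhase_mul_eq_sum_mul_re_torusChar (g : TorusSite 2 M → ℝ) (p : TorusSite 2 M) :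
    ∑ z : TorusSite 2 M, Real.cos (torusPhase M p z) * g z =
      ∑ z : TorusSite 2 M, g z * (torusChar p z).re := by
  refine sum_congr rfl fun z _ => ?_
  rw [show (torusChar p z).re = Real.cos (torusPhase M p z) from
    Literature.MathematicalPhysics.QuantumLattice.torusChar_re M p z, mul_comm]

/-- **The numerator of the infrared wing is `O(κ₀ n²)` uniformly in `M`.** For `M = 2m` even,
`M ≥ 4`, `Δ ∈ [-1, 0]`, a normalised half-filled sector ground state `ψ` of `H_M(Δ)` and `0 < κ₀`:
`Σ_{q ∈ IR(κ₀)} Σ_X k₂(X) Re χ_q(X) ≤ (64/π) κ₀ m²`, by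
`TorusBlock.sum_infrared_blockKernel_mul_re_torusChar_le` (`b = 2`, `C = 2`) fed with the ground-state
infrared bound `sectorGS_transverse_infraredBound_uniform` and translation invariance
`gs_transverseKernel_eq_sub`. [cite: KLS1988JSP, eqs. (17)–(19)] -/
theorem sectorGS_infraredWing_numerator_le (hM : M = 2 * m) (hEven : Even M) (h4 : 4 ≤ M)
    {Δ : ℝ} (hΔ : Δ ∈ Set.Icc (-1 : ℝ) 0)
    (ψ : TensorIndex (TorusSite 2 M) 2 → ℂ)
    (hψ : ψ ∈ @spinZSector (TorusSite 2 M) _ _ 1 0) (hnorm : star ψ ⬝ᵥ ψ = 1)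
    (heig : Matrix.mulVec (xxzHamiltonian 1 (torusGraph 2 M) (-1) Δ) ψ =
      ((lowestEnergyInSector 1 (xxzHamiltonian 1 (torusGraph 2 M) (-1) Δ) 0 : ℝ) : ℂ) • ψ)
    {κ₀ : ℝ} (hκ₀ : 0 < κ₀) :
    ∑ q ∈ (univ.erase (0 : TorusSite 2 m)) \
        univ.filter (fun q : TorusSite 2 m => q ≠ 0 ∧
          ∃ i : Fin 2, (torusChar q (Pi.single i 1)).re ≤ Real.cos κ₀),
      ∑ X : TorusSite 2 m, (∑ x' : TorusSite 2 M, ∑ y' : TorusSite 2 M,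
        if (∀ i : Fin 2, (x' i).val / 2 = (X i).val) ∧ (∀ i : Fin 2, (y' i).val / 2 = 0) then
          (star ψ ⬝ᵥ Matrix.mulVec (onSite x' (spinRaise 1) * onSite y' (spinLower 1)) ψ).re
        else 0) * (torusChar q X).re ≤
      64 / Real.pi * κ₀ * (m : ℝ) ^ 2 := by
  classical
  have hm : 2 ≤ m := by omega
  -- the difference kernel
  set f : TorusSite 2 M → ℝ := fun z =>
    (star ψ ⬝ᵥ Matrix.mulVec (onSite z (spinRaise 1) * onSite 0 (spinLower 1)) ψ).re with hf
  have hsub : ∀ x' y' : TorusSite 2 M,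
      (star ψ ⬝ᵥ Matrix.mulVec (onSite x' (spinRaise 1) * onSite y' (spinLower 1)) ψ).re =
        f (x' - y') := fun x' y' => gs_transverseKernel_eq_sub M hEven Δ ψ hψ hnorm heig x' y'
  -- rewrite the block kernel through `f`
  have hk : ∀ X : TorusSite 2 m, (∑ x' : TorusSite 2 M, ∑ y' : TorusSite 2 M,
      if (∀ i : Fin 2, (x' i).val / 2 = (X i).val) ∧ (∀ i : Fin 2, (y' i).val / 2 = 0) then
        (star ψ ⬝ᵥ Matrix.mulVec (onSite x' (spinRaise 1) * onSite y' (spinLower 1)) ψ).re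
      else 0) =
      ∑ x' : TorusSite 2 M, ∑ y' : TorusSite 2 M,
        if (∀ i : Fin 2, (x' i).val / 2 = (X i).val) ∧ (∀ i : Fin 2, (y' i).val / 2 = 0) then
          f (x' - y') else 0 := fun X =>
    sum_congr rfl fun x' _ => sum_congr rfl fun y' _ => by rw [hsub]
  simp_rw [hk]
  -- the infrared bound in character form
  have hIRb := sectorGS_transverse_infraredBound_uniform M hEven h4 Δ hΔ ψ hψ hnorm heig
  have h0 : ∀ p : TorusSite 2 M, p ≠ 0 → 0 ≤ ∑ x : TorusSite 2 M, f x * (torusChar p x).re := by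
    intro p hp
    rw [← sum_cos_torusPhase_mul_eq_sum_mul_re_torusChar M f p]
    exact (hIRb p hp).1
  have hIR : ∀ p : TorusSite 2 M, p ≠ 0 →
      (∑ x : TorusSite 2 M, f x * (torusChar p x).re) ^ 2 * dispersion (latticeMomentum M p) ≤ 2 := by
    intro p hp
    rw [← sum_cos_torusPhase_mul_eq_sum_mul_re_torusChar M f p]
    exact (hIRb p hp).2
  have hmain := TorusBlock.sum_infrared_blockKernel_mul_re_torusChar_le (b := 2) hM hm f
    (by norm_num : (0:ℝ) ≤ 2) hκ₀ h0 hIR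
  refine hmain.trans (le_of_eq ?_)
  have hsqrt : Real.sqrt ((2 : ℝ) / 8) = 1 / 2 := by
    rw [show (2 : ℝ) / 8 = (1 / 2) ^ 2 by norm_num, Real.sqrt_sq (by norm_num)]
  rw [hsqrt, hM]
  push_cast
  ring

omit [NeZero m] in
/-- **The coarse block kernel at the origin is at least `2`**: `k₂(0) ≥ 4 · ½`, keeping the four
diagonal terms `Re⟨ψ, S⁺_x S⁻_x ψ⟩ = ½` of the origin block (half filling,
`LevyFloor.transverseKernel_diag`) and dropping the positive rest (`LevyFloor.transverseKernel_pos_all`).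
[folklore] -/
theorem two_le_coarseKernel_zero (hEven : Even M) (h4 : 4 ≤ M) (Δ : ℝ)
    (ψ : TensorIndex (TorusSite 2 M) 2 → ℂ)
    (hψ : ψ ∈ @spinZSector (TorusSite 2 M) _ _ 1 0) (hnorm : star ψ ⬝ᵥ ψ = 1)
    (heig : Matrix.mulVec (xxzHamiltonian 1 (torusGraph 2 M) (-1) Δ) ψ =
      ((lowestEnergyInSector 1 (xxzHamiltonian 1 (torusGraph 2 M) (-1) Δ) 0 : ℝ) : ℂ) • ψ) :
    (2 : ℝ) ≤ ∑ x' : TorusSite 2 M, ∑ y' : TorusSite 2 M,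
      if (∀ i : Fin 2, (x' i).val / 2 = ((0 : TorusSite 2 m) i).val) ∧
          (∀ i : Fin 2, (y' i).val / 2 = 0) then
        (star ψ ⬝ᵥ Matrix.mulVec (onSite x' (spinRaise 1) * onSite y' (spinLower 1)) ψ).re
      else 0 := by
  set K : TorusSite 2 M → TorusSite 2 M → ℝ := fun x y =>
    (star ψ ⬝ᵥ Matrix.mulVec (onSite x (spinRaise 1) * onSite y (spinLower 1)) ψ).re with hK
  have hK0 : ∀ x y, 0 ≤ K x y := fun x y =>
    (LevyFloor.transverseKernel_pos_all M hEven h4 Δ ψ hψ hnorm heig x y).le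
  have hdiag : ∀ x, K x x = 1 / 2 := fun x =>
    LevyFloor.transverseKernel_diag M hEven Δ ψ hψ hnorm heig x
  have hfine := LevyFloor.blockKernel_zero_zero_ge K hEven hK0 hdiag
  have hcond : ∀ x' y' : TorusSite 2 M,
      (if (∀ i : Fin 2, (x' i).val / 2 = ((0 : TorusSite 2 m) i).val) ∧
          (∀ i : Fin 2, (y' i).val / 2 = 0) then K x' y' else 0) =
      (if (∀ i : Fin 2, (x' i).val / 2 = ((0 : TorusSite 2 M) i).val / 2) ∧
          (∀ i : Fin 2, (y' i).val / 2 = ((0 : TorusSite 2 M) i).val / 2) then K x' y' else 0) := by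
    intro x' y'
    simp only [Pi.zero_apply, ZMod.val_zero, Nat.zero_div]
  simp only [hK] at hcond hfine
  simp_rw [hcond]
  linarith

/-- **Input (a) of the log-bootstrap, bootstrap form: the infrared wing is at most `32 κ₀ / π`.**
For `M = 2m` even, `M ≥ 4`, `Δ ∈ [-1, 0]`, every normalised half-filled sector ground state `ψ` of
`H_M(Δ)` and every `0 < κ₀`, with the ultraviolet set `S = {q ≠ 0 : ∃ i, Re χ_q(eᵢ) ≤ cos κ₀}`:
`(Σ_{q ∉ S, q ≠ 0} Σ_X k₂(X) Re χ_q(X)) / (m² k₂(0)) ≤ 32 κ₀ / π` — uniformly in `M` and `Δ`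
(`sectorGS_infraredWing_numerator_le`, `two_le_coarseKernel_zero`). [cite: KLS1988JSP, eqs. (17)–(19)] -/
theorem sectorGS_infraredWing_le (hM : M = 2 * m) (hEven : Even M) (h4 : 4 ≤ M)
    {Δ : ℝ} (hΔ : Δ ∈ Set.Icc (-1 : ℝ) 0)
    (ψ : TensorIndex (TorusSite 2 M) 2 → ℂ)
    (hψ : ψ ∈ @spinZSector (TorusSite 2 M) _ _ 1 0) (hnorm : star ψ ⬝ᵥ ψ = 1)
    (heig : Matrix.mulVec (xxzHamiltonian 1 (torusGraph 2 M) (-1) Δ) ψ =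
      ((lowestEnergyInSector 1 (xxzHamiltonian 1 (torusGraph 2 M) (-1) Δ) 0 : ℝ) : ℂ) • ψ)
    {κ₀ : ℝ} (hκ₀ : 0 < κ₀) :
    (∑ q ∈ (univ.erase (0 : TorusSite 2 m)) \
        univ.filter (fun q : TorusSite 2 m => q ≠ 0 ∧
          ∃ i : Fin 2, (torusChar q (Pi.single i 1)).re ≤ Real.cos κ₀),
      ∑ X : TorusSite 2 m, (∑ x' : TorusSite 2 M, ∑ y' : TorusSite 2 M,
        if (∀ i : Fin 2, (x' i).val / 2 = (X i).val) ∧ (∀ i : Fin 2, (y' i).val / 2 = 0) then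
          (star ψ ⬝ᵥ Matrix.mulVec (onSite x' (spinRaise 1) * onSite y' (spinLower 1)) ψ).re
        else 0) * (torusChar q X).re) /
      (((m : ℕ) : ℝ) ^ 2 * (∑ x' : TorusSite 2 M, ∑ y' : TorusSite 2 M,
        if (∀ i : Fin 2, (x' i).val / 2 = ((0 : TorusSite 2 m) i).val) ∧
            (∀ i : Fin 2, (y' i).val / 2 = 0) then
          (star ψ ⬝ᵥ Matrix.mulVec (onSite x' (spinRaise 1) * onSite y' (spinLower 1)) ψ).re
        else 0)) ≤ 32 * κ₀ / Real.pi := by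
  have hnum := sectorGS_infraredWing_numerator_le M hM hEven h4 hΔ ψ hψ hnorm heig hκ₀
  have hk0 := two_le_coarseKernel_zero M (m := m) hEven h4 Δ ψ hψ hnorm heig
  have hm0 : (0 : ℝ) < ((m : ℕ) : ℝ) := Nat.cast_pos.2 (Nat.pos_of_ne_zero (NeZero.ne m))
  have hden : (0 : ℝ) < ((m : ℕ) : ℝ) ^ 2 * 2 := by positivity
  rw [div_le_iff₀ (by positivity)]
  calc _ ≤ 64 / Real.pi * κ₀ * (m : ℝ) ^ 2 := hnum
    _ = 32 * κ₀ / Real.pi * (((m : ℕ) : ℝ) ^ 2 * 2) := by ring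
    _ ≤ 32 * κ₀ / Real.pi * (((m : ℕ) : ℝ) ^ 2 * _) := by
        refine mul_le_mul_of_nonneg_left (mul_le_mul_of_nonneg_left hk0 (sq_nonneg _)) ?_
        positivity

end Wing

/-- **Input (a) of `logBootstrap_explicit_of_inputs`, `∀`-closed in its literal shape** (crux
`LevyTransport`, stmt-HubbardSuperconductivity-15049): for every `0 < κ₀`, every even `M ≥ 4`,
every `Δ ∈ [-1, 0]` and every normalised `S^z_tot = 0` sector ground state `ψ` of
`xxzHamiltonian 1 (torusGraph 2 M) (-1) Δ`, the infrared wing of the coarse 2×2-block kernel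
relative to the threshold `t = cos κ₀` is at most `β₀ = 32 κ₀ / π`, uniformly in `M` and `Δ`:
the Gaussian-domination infrared bound (reflection positivity) converted into the smallness of the
infrared part of the block kernel's spectral measure. With input (b) (`local_logCoherence_le_of_lower`)
this is hypothesis `hInputs` of `logBootstrap_explicit_of_inputs` at `t = cos κ₀`; whether (d)
`β₀ e^{U₀+1} < 1` can then be met at block size `2` is the quantitative question recorded on the
item. [cite: KLS1988JSP, eqs. (17)–(19)] -/
theorem infraredWing_le_uniform :
    ∀ κ₀ : ℝ, 0 < κ₀ → ∀ (M : ℕ) [NeZero M] [NeZero (M / 2)], Even M → 4 ≤ M →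
      ∀ Δ ∈ Set.Icc (-1 : ℝ) 0, ∀ ψ : TensorIndex (TorusSite 2 M) 2 → ℂ,
      (ψ ∈ @spinZSector (TorusSite 2 M) _ _ 1 0 ∧ star ψ ⬝ᵥ ψ = 1 ∧
        Matrix.mulVec (xxzHamiltonian 1 (torusGraph 2 M) (-1) Δ) ψ =
          ((lowestEnergyInSector 1 (xxzHamiltonian 1 (torusGraph 2 M) (-1) Δ) 0 : ℝ) : ℂ) • ψ) →
      (∑ q ∈ (Finset.univ.erase 0) \
            (Finset.univ.filter (fun q : TorusSite 2 (M / 2) => q ≠ 0 ∧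
              ∃ i : Fin 2, (torusChar q (Pi.single i 1)).re ≤ Real.cos κ₀)),
          ∑ X : TorusSite 2 (M / 2),
          (∑ x' : TorusSite 2 M, ∑ y' : TorusSite 2 M,
            if (∀ i : Fin 2, (x' i).val / 2 = (X i).val) ∧ (∀ i : Fin 2, (y' i).val / 2 = 0) then
              (star ψ ⬝ᵥ Matrix.mulVec
                (onSite x' (spinRaise 1) * onSite y' (spinLower 1)) ψ).re
            else 0) * (torusChar q X).re) /
        ((((M / 2 : ℕ)) : ℝ) ^ 2 * (∑ x' : TorusSite 2 M, ∑ y' : TorusSite 2 M,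
            if (∀ i : Fin 2, (x' i).val / 2 = ((0 : TorusSite 2 (M / 2)) i).val) ∧
              (∀ i : Fin 2, (y' i).val / 2 = 0) then
              (star ψ ⬝ᵥ Matrix.mulVec
                (onSite x' (spinRaise 1) * onSite y' (spinLower 1)) ψ).re
            else 0)) ≤ 32 * κ₀ / Real.pi := by
  intro κ₀ hκ₀ M _ _ hEven h4 Δ hΔ ψ hgs
  obtain ⟨hψ, hnorm, heig⟩ := hgs
  have hM : M = 2 * (M / 2) := (Nat.two_mul_div_two_of_even hEven).symm
  exact sectorGS_infraredWing_le M hM hEven h4 hΔ ψ hψ hnorm heig hκ₀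

end Summit.HubbardSuperconductivity.HubbardSuperconductivity.Theorems.LevyLogBootstrap

end
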